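import Literature.NumberTheory.Transcendental.KZHyperbolicLadder
import Literature.NumberTheory.Transcendental.KZCalculusProofs
import Summits.KontsevichZagierPeriods.KontsevichZagierPeriods.Theorems.HyperbolicBlochOffTetraSectorKernelStubStripStructure
import Summits.KontsevichZagierPeriods.KontsevichZagierPeriods.Theorems.HyperbolicBlochOffTetraSectorKernelStubVPiece
import Summits.KontsevichZagierPeriods.KontsevichZagierPeriods.Theorems.HyperbolicBlochOffTetraSectorKernelStubVerticalCuts
import Summits.KontsevichZagierPeriods.KontsevichZagierPeriods.Theorems.HyperbolicBlochOffTetraSectorKernelStubThreeTriangles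
import Summits.KontsevichZagierPeriods.KontsevichZagierPeriods.Theorems.HyperbolicBlochOffTetraSectorKernelStubAngleKernel
import Summits.KontsevichZagierPeriods.KontsevichZagierPeriods.Theorems.HyperbolicBlochOffTetraSectorKernelLadderFamilyExists
import Literature.NumberTheory.Transcendental.KZLogCalculusProofs

/-!
# Rung 1 of the hyperbolic scissors ladder closes — crux `OffTetraSectorKernel`, line `odd-hyperbolic-ladder` (v4/v5, lead c3)

**Every `ℤ`-linear relation among areas of finite-area `ℚ̄`-geodesic polygons of the hyperbolic plane is a
Kontsevich–Zagier relation among their representations `[P, t⁻²]`**: `rungOne_subset : KZ.rungRelators 1 ⊆ KZ.relations`.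
Area is the complete scissors-congruence invariant of `ℍ²`, and the calculus of moves sees it: vertical geodesic cuts
make every polygon a signed sum of singly-ideal triangles (`stub_stripStructure`, `stub_verticalCuts`, `stub_vPiece`),
one boundary similarity makes each of those a difference of two standard doubly-ideal triangles `Std γ` (value
`arccos γ`), the three-triangle relation `[Std a] + [Std b] + [Std c] ≡ [Std (−1)]` (`arccos a + arccos b + arccos c = π`;
`stub_threeTriangles`, one boundary rotation) makes the `Std` classes add like angles, and the value relation is spent
exactly once as the equality of two total angles (`stub_angleKernel`). No transcendence input — the weight-one
analogue of rung 0 (`interval_log_relation_mem_relations`, lead c1).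

References: M. Kontsevich, D. Zagier, *Periods* (2001), §1.2; W. D. Neumann, *Hilbert's 3rd problem and invariants of
3-manifolds* (1998), §2; J. Ratcliffe, *Foundations of hyperbolic manifolds*, §3.5.
-/

noncomputable section

open Set MeasureTheory
open Literature.NumberTheory.Transcendental

namespace Summit.KontsevichZagierPeriods.HyperbolicBloch.OffTetraSectorKernel

/-- **Rung 1 of the hyperbolic ladder closes unconditionally**: every `ℤ`-linear relation among areas of finite-area
`ℚ̄`-geodesic polygons of `ℍ²` is a Kontsevich–Zagier relation among their representations `[P, t⁻²]`.
[cite: KontsevichZagier2001, §1.2] -/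
theorem rungOne_subset : KZ.rungRelators 1 ⊆ (KZ.relations : Set KZ.FormalRep) := by
  classical
  set V : ℝ → ℝ → ℝ → ℝ → Set (Fin 2 → ℝ) := fun α β a c => {p | α < p 0 ∧ p 0 < β ∧ 0 < p 1 ∧
    c < (p 0 - a) ^ 2 + p 1 ^ 2} with hVdef
  have hV : ∀ α β a c, V α β a c = {p | α < p 0 ∧ p 0 < β ∧ 0 < p 1 ∧ c < (p 0 - a) ^ 2 + p 1 ^ 2} :=
    fun _ _ _ _ => rfl
  have hdens : ∀ p : Fin 2 → ℝ, KZ.hypDensity 1 p = 1 / p 1 ^ 2 := fun p => by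
    simp [KZ.hypDensity, Fin.last]
  rintro d ⟨ρ, hρ, k, P, m, hP, hsum, rfl⟩
  -- vertical cuts of every polygon
  have hcut := fun i => stub_verticalCuts V hV stub_stripStructure ((stub_vPiece V hV).1) (P i) (hP i) (ρ (P i))
    (hρ (P i) (hP i)).1 (fun p hp => by rw [(hρ (P i) (hP i)).2 hp, hdens])
  choose n α β a c s W hdata hW hrel using hcut
  -- values
  have hval : ∀ i, (ρ (P i)).value = ∑ j, (s i j : ℝ) * (W i j).value := fun i => by
    have h0 := KZ.relations_le_ker_eval_holds (hrel i)
    rw [AddMonoidHom.mem_ker, map_sub, map_sum, KZ.eval_of] at h0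
    simp only [map_zsmul, KZ.eval_of, zsmul_eq_mul] at h0
    linarith
  -- flatten the pieces over `Σ i, Fin (n i)`
  let ι := Σ i : Fin k, Fin (n i)
  have hker : ∑ l : ι, ((m l.1 * s l.1 l.2 : ℤ) : ℝ) * (W l.1 l.2).value = 0 := by
    have : ∑ l : ι, ((m l.1 * s l.1 l.2 : ℤ) : ℝ) * (W l.1 l.2).value =
        ∑ i, (m i : ℝ) * ∑ j, (s i j : ℝ) * (W i j).value := by
      rw [Fintype.sum_sigma]
      refine Finset.sum_congr rfl fun i _ => ?_
      rw [Finset.mul_sum]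
      refine Finset.sum_congr rfl fun j _ => ?_
      push_cast
      ring
    rw [this]
    simpa only [hval] using hsum
  have hK := stub_angleKernel V hV (stub_threeTriangles V hV (stub_vPiece V hV).1) (stub_vPiece V hV).1
    (stub_vPiece V hV).2 ι
    (fun l => α l.1 l.2) (fun l => β l.1 l.2) (fun l => a l.1 l.2) (fun l => c l.1 l.2)
    (fun l => m l.1 * s l.1 l.2) (fun l => W l.1 l.2) (fun l => hdata l.1 l.2)
    (fun l => ⟨(hW l.1 l.2).1, fun p _ => by rw [(hW l.1 l.2).2]⟩) hker
  -- reassemble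
  have hsplit : ∑ i, m i • KZ.of (ρ (P i)) =
      ∑ i, m i • (KZ.of (ρ (P i)) - ∑ j, s i j • KZ.of (W i j)) + ∑ l : ι, (m l.1 * s l.1 l.2) • KZ.of (W l.1 l.2) := by
    rw [Fintype.sum_sigma]
    simp only [smul_sub, Finset.sum_sub_distrib, mul_smul, ← Finset.smul_sum]
    abel
  rw [hsplit]
  exact add_mem (sum_mem fun i _ => zsmul_mem (hrel i) _) hK

/-- **Hilbert's third problem for `ℚ̄`-geodesic polygons of `ℍ²`, inside the calculus**: two Kontsevich–Zagier
representations `[P, t⁻²]`, `[P', t⁻²]` of the areas of finite-area `ℚ̄`-geodesic polygons with the SAME area are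
KZ-equivalent (a two-term instance of `rungOne_subset` for a ladder family through `r` and `r'`).
[cite: KontsevichZagier2001, §1.2] -/
theorem equivalent_of_area_eq {P P' : Set (Fin 2 → ℝ)} (hP : KZ.IsGeodesicPolytope 1 P)
    (hP' : KZ.IsGeodesicPolytope 1 P') (r r' : KZ.IntegralRep 2) (hr : r.domain = P)
    (hri : EqOn r.integrand (KZ.hypDensity 1) P) (hr' : r'.domain = P') (hri' : EqOn r'.integrand (KZ.hypDensity 1) P')
    (hval : r.value = r'.value) : KZ.Equivalent r r' := by
  classical
  by_cases hPP : P = P'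
  · subst hPP
    exact KZ.of_sub_of_mem_relations_of_eqOn (hr'.trans hr.symm) fun p hp => by
      rw [hri (hr ▸ hp), hri' (hr ▸ hp)]
  obtain ⟨ρ₁, hρ₁⟩ := exists_isLadderFamily 1
  set ρ : Set (Fin 2 → ℝ) → KZ.IntegralRep 2 := fun S => if S = P then r else if S = P' then r' else ρ₁ S with hρ
  have hρP : ρ P = r := by simp [hρ]
  have hρP' : ρ P' = r' := by simp [hρ, Ne.symm hPP]
  have hfam : KZ.IsLadderFamily 1 ρ := by
    intro S hS
    by_cases h1 : S = P
    · subst h1; rw [hρP]; exact ⟨hr, hri⟩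
    by_cases h2 : S = P'
    · subst h2; rw [hρP']; exact ⟨hr', hri'⟩
    simp only [hρ, if_neg h1, if_neg h2]
    exact hρ₁ S hS
  have hmem : (∑ i : Fin 2, (![1, -1] : Fin 2 → ℤ) i • KZ.of (ρ ((![P, P'] : Fin 2 → Set (Fin 2 → ℝ)) i))) ∈
      KZ.rungRelators 1 := by
    refine ⟨ρ, hfam, 2, ![P, P'], ![1, -1], fun i => ?_, ?_, rfl⟩
    · fin_cases i
      · simpa using hP
      · simpa using hP'
    · simp [Fin.sum_univ_two, hρP, hρP', hval]
  have h := rungOne_subset hmem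
  simpa [Fin.sum_univ_two, hρP, hρP', KZ.Equivalent, sub_eq_add_neg] using h


end Summit.KontsevichZagierPeriods.HyperbolicBloch.OffTetraSectorKernel

end
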